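import Summits.MatrixMultiplication.OmegaCensus.DominoZ5Z5Cover8A
import HarnessLib

/-!
# Kernel covers on `ZMod 5 × ZMod 5`: part `8` (B: chunks 3–5)

ω-census `pub-omega`, family (b3), seat pub-omega-group gen 20.  Framing: lottery ticket; floor = certified bounds/negative
ranges.  VALUE: the finite kernel computation behind the `ℤ_5 × ℤ_5` domino cell theorems with a part `8` (`DominoZ5Z5Part8.lean`); NOT progress on ω.

Instances of the generic margin-pruned enumeration `DominoZpZpCover.lean`: per part size `d`, the search tree of the
codes of the UNcertified 1-D multisets (`passTree…`, untrusted), its extensional soundness against the certified table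
(`…_sound`, `decide`), the kernel cover computations (`cover_…`, `decide`; normal form (i) chunked), and the assembled
semantic statement `exists_table_entry_5_8` consumed by the cell theorems.  Enumeration sizes (leaves / nodes, exact
Python twin `pub-omega-group-g20/code/emulate.py`): see part A.
-/

namespace Summit.MatrixMultiplication.OmegaCensus

namespace ZpZpDomino

set_option maxHeartbeats 4000000 in
/-- Kernel cover computation, `p = 5`, `d = 8`, normal form (i), chunk `3` of `9`. [folklore] -/
theorem cover_5_8_nf1_3 : coverNF1 5 8 passTreeZ5d8 2 9 3 = true := by decide +kernel

set_option maxHeartbeats 4000000 in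
/-- Kernel cover computation, `p = 5`, `d = 8`, normal form (i), chunk `4` of `9`. [folklore] -/
theorem cover_5_8_nf1_4 : coverNF1 5 8 passTreeZ5d8 2 9 4 = true := by decide +kernel

set_option maxHeartbeats 4000000 in
/-- Kernel cover computation, `p = 5`, `d = 8`, normal form (i), chunk `5` of `9`. [folklore] -/
theorem cover_5_8_nf1_5 : coverNF1 5 8 passTreeZ5d8 2 9 5 = true := by decide +kernel

end ZpZpDomino

end Summit.MatrixMultiplication.OmegaCensus
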